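import Summits.ValiantsHypothesis.ValiantsHypothesis.Theorems.LacunarySymmetroidMatrixDescartesDoorA26WallBubblingOnePairWallLimit
import Summits.ValiantsHypothesis.ValiantsHypothesis.Theorems.LacunarySymmetroidMatrixDescartesDoorA26WallBubblingOnePairWallNondeg
import Summits.ValiantsHypothesis.ValiantsHypothesis.Theorems.LacunarySymmetroidMatrixDescartesDoorA26WallBubblingWeylGenericSingleCluster

/-!
# Wall bubbling for `DoorA26` — ONE WEYL PAIR ON A WALL (cases (a), (b)): THE SINGLE-CLUSTER BRANCH IS DOOR-FREE

HONEST FRAMING.  Obligation (W) `stub_weylFaces` of `Cruxes/DoorA26/Lines/wall_bubbling.lean` (crux `DoorA26`, stmt-ValiantsHypothesis-19979;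
OPEN, typed, never asserted); statement file `Cruxes/DoorA26/Lines/wall_bubbling_ConfluentDoor.lean` rev 4, stratum `Stmt.weylFaces_wall` with ONE
Weyl pair (`δ₀ = δ₅`) and one disjoint-type relation: (a) `δ₁ + δ₂ = δ₃ + δ₄`, (b) `δ₀ + δ₁ = δ₂ + δ₃` (W1 #14 itemisation: these are ALL one-pair
sub-strata up to relabelling).  W1 seat val-sym-door-p2 g13 (#36).  At a GENERIC face the single-cluster branch needs the door `ConfluentDoor26`
(W2 #16); ON THE WALL it does not — the confluent determinant's count drops to `≤ 19` at a coincidence of its exponents (W1 #12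
`confluentDoor_conclusion_of_coincidence`), and the limit is non-degenerate by inertia (W1 #35):

* `no_twenty_window_onePairWall_of_nondeg` — MASTER (any one-pair point whose five values carry a coincidence of two distinct canonical pair sums,
  given the stratum's non-degeneracy): twenty zeros in a fixed window are impossible, NO DOOR (`onePairLimit` W1 #34 + W2's
  `multiplicity_transfer_iteratedDeriv` + W1 #12);
* **`no_twenty_window_onePairWallA`**, **`no_twenty_window_onePairWallB`** — the two strata, UNCONDITIONALLY;
* `no_boundedRatio_twenties_onePairWall_of_nondeg`, **`no_boundedRatio_twenties_onePairWallA/B`** — `x`-currency.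

With W1 #28 (two pairs, (c1)/(c2)/(c3)) the single-cluster / bounded-ratio branch of the WHOLE stratum `Stmt.weylFaces_wall` is door-free in the
kernel: twenties accumulating at a Weyl ∩ disjoint-wall point SPLIT.  The multi-cluster case is the shared (W-split) middle.  Registers unchanged; (W),
`ConfluentDoor26`, `DoorA26`, `MatrixDescartes` (stmt-ValiantsHypothesis-18050) OPEN; nothing on VP ≠ VNP.  `--supports stmt-ValiantsHypothesis-19979
--as helper`.  [this work] the assembly.
-/

-- `Summit.ValiantsHypothesis.ValiantsHypothesis.…` repeats a component by the D-0017 layout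
-- (single-conjunct summit), which the `dupNamespace` linter flags; the name is mandated.
set_option linter.dupNamespace false

namespace Summit.ValiantsHypothesis.ValiantsHypothesis.Theorems.LacunarySymmetroidMatrixDescartes.WallBubbling

open Finset Filter Topology
open Bubbling (polar confluentDoor_conclusion_of_coincidence)
open scoped BigOperators

/-! ## 1. The master window lemma at a one-pair wall point -/

/-- **NO TWENTY IN A WINDOW AT A ONE-PAIR WALL POINT, GIVEN THE STRATUM'S NON-DEGENERACY — NO DOOR.**  The pair at `0,5`; the five values
`δ0 0, …, δ0 4` carry a coincidence of two distinct canonical pair sums (`hcoin`). [this work] -/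
theorem no_twenty_window_onePairWall_of_nondeg
    (δs : ℕ → Fin 6 → ℝ) (δ0 : Fin 6 → ℝ) (hδ : ∀ l, Tendsto (fun ν => δs ν l) atTop (𝓝 (δ0 l))) (h05 : δ0 5 = δ0 0)
    (hcoin : ∃ a b c d : Fin 5, a ≤ b ∧ c ≤ d ∧ (a, b) ≠ (c, d) ∧ δ0 a.castSucc + δ0 b.castSucc = δ0 c.castSucc + δ0 d.castSucc)
    (hnd : ∀ W : Fin 6 → Matrix (Fin 2) (Fin 2) ℝ, (∀ l, (W l).IsSymm) → (∃ p q, polar (W p) (W q) ≠ 0) →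
      ∃ t, ((Real.exp (δ0 0 * t)) • (W 0 + t • W 5) + ∑ k : Fin 4, (Real.exp (δ0 k.succ.castSucc * t)) • W k.succ.castSucc).det ≠ 0)
    (U : ℕ → Fin 6 → Matrix (Fin 2) (Fin 2) ℝ) (hU : ∀ ν l, (U ν l).IsSymm)
    (hne : ∀ ν, ∃ t, (∑ l, Real.exp (δs ν l * t) • U ν l).det ≠ 0)
    (A B : ℝ) (hz : ∀ ν, ∃ z : Fin 20 → ℝ, StrictMono z ∧ ∀ i, z i ∈ Set.Icc A B ∧ (∑ l, Real.exp (δs ν l * z i) • U ν l).det = 0) :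
    False := by
  obtain ⟨φ, hφ, a, W, hWs, hWne, hconv⟩ := onePairLimit δs δ0 hδ h05 U hU hne
  have hne' := hnd W hWs hWne
  obtain ⟨e, he⟩ : ∃ e : Fin 5 → ℝ, ∀ m, e m = δ0 m.castSucc := ⟨fun m => δ0 m.castSucc, fun m => rfl⟩
  have he0 : e 0 = δ0 0 := by rw [he, Fin.castSucc_zero]
  have hes : ∀ k : Fin 4, e k.succ = δ0 k.succ.castSucc := fun k => he k.succ
  have hfun : (fun t : ℝ => ((Real.exp (e 0 * t)) • (W 0 + t • W 5) + ∑ k : Fin 4, (Real.exp (e k.succ * t)) • W k.succ.castSucc).det)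
      = (fun t => ((Real.exp (δ0 0 * t)) • (W 0 + t • W 5) + ∑ k : Fin 4, (Real.exp (δ0 k.succ.castSucc * t)) • W k.succ.castSucc).det) := by
    simp only [he0, hes]
  have hcoin' : ∃ a b c d : Fin 5, a ≤ b ∧ c ≤ d ∧ (a, b) ≠ (c, d) ∧ e a + e b = e c + e d := by
    obtain ⟨a', b', c', d', h1, h2, h3, h4⟩ := hcoin
    exact ⟨a', b', c', d', h1, h2, h3, by rw [he, he, he, he]; exact h4⟩
  obtain ⟨Z, m, hZ, h20⟩ := multiplicity_transfer_iteratedDeriv A B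
    (fun k t => a k * (∑ l, Real.exp (δs (φ k) l * t) • U (φ k) l).det)
    (fun t => ((Real.exp (δ0 0 * t)) • (W 0 + t • W 5) + ∑ k : Fin 4, (Real.exp (δ0 k.succ.castSucc * t)) • W k.succ.castSucc).det)
    (fun k n => contDiff_const.mul (contDiff_pencilDet _ _ n))
    (fun j _ ψ hψ t t₀ _ ht => hconv j ψ hψ t t₀ ht)
    (fun k => by
      obtain ⟨z, hz1, hz2⟩ := hz (φ k)
      exact ⟨z, hz1, fun i => ⟨(hz2 i).1, by rw [(hz2 i).2, mul_zero]⟩⟩)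
  have h19 := confluentDoor_conclusion_of_coincidence e (W 0) (W 5) (fun k => W k.succ.castSucc) hcoin'
    (by simp only [he0, hes]; exact hne') Z m (fun z hz' j hj => by rw [hfun]; exact (hZ z hz').2 j hj)
  omega

/-! ## 2. The two one-pair wall strata, unconditionally -/

/-- **NO TWENTY IN A WINDOW AT A ONE-PAIR POINT ON THE WALL (a) `δ₁ + δ₂ = δ₃ + δ₄` — NO DOOR.** [this work] -/
theorem no_twenty_window_onePairWallA
    (δs : ℕ → Fin 6 → ℝ) (δ0 : Fin 6 → ℝ) (hδ : ∀ l, Tendsto (fun ν => δs ν l) atTop (𝓝 (δ0 l))) (h05 : δ0 5 = δ0 0)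
    (hrel : δ0 1 + δ0 2 = δ0 3 + δ0 4)
    (hgen : ∀ a b c e : Fin 5, δ0 a.castSucc + δ0 b.castSucc = δ0 c.castSucc + δ0 e.castSucc →
      (a = c ∧ b = e) ∨ (a = e ∧ b = c) ∨
        (((a = 1 ∧ b = 2) ∨ (a = 2 ∧ b = 1)) ∧ ((c = 3 ∧ e = 4) ∨ (c = 4 ∧ e = 3))) ∨
        (((a = 3 ∧ b = 4) ∨ (a = 4 ∧ b = 3)) ∧ ((c = 1 ∧ e = 2) ∨ (c = 2 ∧ e = 1))))
    (U : ℕ → Fin 6 → Matrix (Fin 2) (Fin 2) ℝ) (hU : ∀ ν l, (U ν l).IsSymm)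
    (hne : ∀ ν, ∃ t, (∑ l, Real.exp (δs ν l * t) • U ν l).det ≠ 0)
    (A B : ℝ) (hz : ∀ ν, ∃ z : Fin 20 → ℝ, StrictMono z ∧ ∀ i, z i ∈ Set.Icc A B ∧ (∑ l, Real.exp (δs ν l * z i) • U ν l).det = 0) :
    False :=
  no_twenty_window_onePairWall_of_nondeg δs δ0 hδ h05 ⟨1, 2, 3, 4, by decide, by decide, by decide, hrel⟩
    (fun W hWs hWne => confluentDet_ne_zero_of_polar_ne_zero_wallA δ0 h05 hrel hgen W hWs hWne) U hU hne A B hz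

/-- **NO TWENTY IN A WINDOW AT A ONE-PAIR POINT ON THE WALL (b) `δ₀ + δ₁ = δ₂ + δ₃` — NO DOOR.** [this work] -/
theorem no_twenty_window_onePairWallB
    (δs : ℕ → Fin 6 → ℝ) (δ0 : Fin 6 → ℝ) (hδ : ∀ l, Tendsto (fun ν => δs ν l) atTop (𝓝 (δ0 l))) (h05 : δ0 5 = δ0 0)
    (hrel : δ0 0 + δ0 1 = δ0 2 + δ0 3)
    (hgen : ∀ a b c e : Fin 5, δ0 a.castSucc + δ0 b.castSucc = δ0 c.castSucc + δ0 e.castSucc →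
      (a = c ∧ b = e) ∨ (a = e ∧ b = c) ∨
        (((a = 0 ∧ b = 1) ∨ (a = 1 ∧ b = 0)) ∧ ((c = 2 ∧ e = 3) ∨ (c = 3 ∧ e = 2))) ∨
        (((a = 2 ∧ b = 3) ∨ (a = 3 ∧ b = 2)) ∧ ((c = 0 ∧ e = 1) ∨ (c = 1 ∧ e = 0))))
    (U : ℕ → Fin 6 → Matrix (Fin 2) (Fin 2) ℝ) (hU : ∀ ν l, (U ν l).IsSymm)
    (hne : ∀ ν, ∃ t, (∑ l, Real.exp (δs ν l * t) • U ν l).det ≠ 0)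
    (A B : ℝ) (hz : ∀ ν, ∃ z : Fin 20 → ℝ, StrictMono z ∧ ∀ i, z i ∈ Set.Icc A B ∧ (∑ l, Real.exp (δs ν l * z i) • U ν l).det = 0) :
    False :=
  no_twenty_window_onePairWall_of_nondeg δs δ0 hδ h05 ⟨0, 1, 2, 3, by decide, by decide, by decide, hrel⟩
    (fun W hWs hWne => confluentDet_ne_zero_of_polar_ne_zero_wallB δ0 h05 hrel hgen W hWs hWne) U hU hne A B hz

/-! ## 3. The `x`-currency statements -/

/-- **NO BOUNDED-RATIO TWENTIES NEAR A ONE-PAIR WALL POINT, GIVEN THE STRATUM'S NON-DEGENERACY — NO DOOR.** [this work] -/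
theorem no_boundedRatio_twenties_onePairWall_of_nondeg
    (δ0 : Fin 6 → ℝ) (h05 : δ0 5 = δ0 0)
    (hcoin : ∃ a b c d : Fin 5, a ≤ b ∧ c ≤ d ∧ (a, b) ≠ (c, d) ∧ δ0 a.castSucc + δ0 b.castSucc = δ0 c.castSucc + δ0 d.castSucc)
    (hnd : ∀ W : Fin 6 → Matrix (Fin 2) (Fin 2) ℝ, (∀ l, (W l).IsSymm) → (∃ p q, polar (W p) (W q) ≠ 0) →
      ∃ t, ((Real.exp (δ0 0 * t)) • (W 0 + t • W 5) + ∑ k : Fin 4, (Real.exp (δ0 k.succ.castSucc * t)) • W k.succ.castSucc).det ≠ 0)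
    (δs : ℕ → Fin 6 → ℝ) (hδ : ∀ l, Tendsto (fun ν => δs ν l) atTop (𝓝 (δ0 l)))
    (S : ℕ → Fin 6 → Matrix (Fin 2) (Fin 2) ℝ) (hS : ∀ ν l, (S ν l).IsSymm)
    (hne : ∀ ν, ∃ y : ℝ, 0 < y ∧ (∑ l, (y ^ (δs ν l)) • S ν l).det ≠ 0)
    (R : ℝ) (x : ℕ → Fin 20 → ℝ) (hx : ∀ ν, StrictMono (x ν)) (hxpos : ∀ ν k, 0 < x ν k)
    (hxR : ∀ ν k, x ν k ≤ R * x ν 0) (hroot : ∀ ν k, (∑ l, (x ν k ^ (δs ν l)) • S ν l).det = 0) : False := by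
  have hR : 0 < R := by
    have h1 := hxR 0 0
    have h2 := hxpos 0 0
    nlinarith
  refine no_twenty_window_onePairWall_of_nondeg δs δ0 hδ h05 hcoin hnd
    (fun ν l => (x ν 0 ^ (δs ν l)) • S ν l) (fun ν l => (hS ν l).smul _) ?_ 0 (Real.log R) ?_
  · intro ν
    obtain ⟨y, hy, hdet⟩ := hne ν
    refine ⟨Real.log y - Real.log (x ν 0), ?_⟩
    rw [← pencil_log_recenter (δs ν) (S ν) (hxpos ν 0) hy]
    exact hdet
  · intro ν
    refine ⟨fun k => Real.log (x ν k) - Real.log (x ν 0), fun k k' hkk' => ?_, fun k => ⟨⟨?_, ?_⟩, ?_⟩⟩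
    · exact sub_lt_sub_right (Real.log_lt_log (hxpos ν k) (hx ν hkk')) _
    · exact sub_nonneg.mpr (Real.log_le_log (hxpos ν 0) ((hx ν).monotone (Fin.zero_le k)))
    · rw [sub_le_iff_le_add, ← Real.log_mul hR.ne' (hxpos ν 0).ne']
      exact Real.log_le_log (hxpos ν k) (hxR ν k)
    · rw [← pencil_log_recenter (δs ν) (S ν) (hxpos ν 0) (hxpos ν k)]
      exact hroot ν k

/-- **NO BOUNDED-RATIO TWENTIES NEAR A ONE-PAIR POINT ON THE WALL (a) — NO DOOR.** [this work] -/
theorem no_boundedRatio_twenties_onePairWallA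
    (δ0 : Fin 6 → ℝ) (h05 : δ0 5 = δ0 0) (hrel : δ0 1 + δ0 2 = δ0 3 + δ0 4)
    (hgen : ∀ a b c e : Fin 5, δ0 a.castSucc + δ0 b.castSucc = δ0 c.castSucc + δ0 e.castSucc →
      (a = c ∧ b = e) ∨ (a = e ∧ b = c) ∨
        (((a = 1 ∧ b = 2) ∨ (a = 2 ∧ b = 1)) ∧ ((c = 3 ∧ e = 4) ∨ (c = 4 ∧ e = 3))) ∨
        (((a = 3 ∧ b = 4) ∨ (a = 4 ∧ b = 3)) ∧ ((c = 1 ∧ e = 2) ∨ (c = 2 ∧ e = 1))))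
    (δs : ℕ → Fin 6 → ℝ) (hδ : ∀ l, Tendsto (fun ν => δs ν l) atTop (𝓝 (δ0 l)))
    (S : ℕ → Fin 6 → Matrix (Fin 2) (Fin 2) ℝ) (hS : ∀ ν l, (S ν l).IsSymm)
    (hne : ∀ ν, ∃ y : ℝ, 0 < y ∧ (∑ l, (y ^ (δs ν l)) • S ν l).det ≠ 0)
    (R : ℝ) (x : ℕ → Fin 20 → ℝ) (hx : ∀ ν, StrictMono (x ν)) (hxpos : ∀ ν k, 0 < x ν k)
    (hxR : ∀ ν k, x ν k ≤ R * x ν 0) (hroot : ∀ ν k, (∑ l, (x ν k ^ (δs ν l)) • S ν l).det = 0) : False :=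
  no_boundedRatio_twenties_onePairWall_of_nondeg δ0 h05 ⟨1, 2, 3, 4, by decide, by decide, by decide, hrel⟩
    (fun W hWs hWne => confluentDet_ne_zero_of_polar_ne_zero_wallA δ0 h05 hrel hgen W hWs hWne)
    δs hδ S hS hne R x hx hxpos hxR hroot

/-- **NO BOUNDED-RATIO TWENTIES NEAR A ONE-PAIR POINT ON THE WALL (b) — NO DOOR.** [this work] -/
theorem no_boundedRatio_twenties_onePairWallB
    (δ0 : Fin 6 → ℝ) (h05 : δ0 5 = δ0 0) (hrel : δ0 0 + δ0 1 = δ0 2 + δ0 3)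
    (hgen : ∀ a b c e : Fin 5, δ0 a.castSucc + δ0 b.castSucc = δ0 c.castSucc + δ0 e.castSucc →
      (a = c ∧ b = e) ∨ (a = e ∧ b = c) ∨
        (((a = 0 ∧ b = 1) ∨ (a = 1 ∧ b = 0)) ∧ ((c = 2 ∧ e = 3) ∨ (c = 3 ∧ e = 2))) ∨
        (((a = 2 ∧ b = 3) ∨ (a = 3 ∧ b = 2)) ∧ ((c = 0 ∧ e = 1) ∨ (c = 1 ∧ e = 0))))
    (δs : ℕ → Fin 6 → ℝ) (hδ : ∀ l, Tendsto (fun ν => δs ν l) atTop (𝓝 (δ0 l)))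
    (S : ℕ → Fin 6 → Matrix (Fin 2) (Fin 2) ℝ) (hS : ∀ ν l, (S ν l).IsSymm)
    (hne : ∀ ν, ∃ y : ℝ, 0 < y ∧ (∑ l, (y ^ (δs ν l)) • S ν l).det ≠ 0)
    (R : ℝ) (x : ℕ → Fin 20 → ℝ) (hx : ∀ ν, StrictMono (x ν)) (hxpos : ∀ ν k, 0 < x ν k)
    (hxR : ∀ ν k, x ν k ≤ R * x ν 0) (hroot : ∀ ν k, (∑ l, (x ν k ^ (δs ν l)) • S ν l).det = 0) : False :=
  no_boundedRatio_twenties_onePairWall_of_nondeg δ0 h05 ⟨0, 1, 2, 3, by decide, by decide, by decide, hrel⟩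
    (fun W hWs hWne => confluentDet_ne_zero_of_polar_ne_zero_wallB δ0 h05 hrel hgen W hWs hWne)
    δs hδ S hS hne R x hx hxpos hxR hroot

end Summit.ValiantsHypothesis.ValiantsHypothesis.Theorems.LacunarySymmetroidMatrixDescartes.WallBubbling
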